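import Mathlib
import HarnessLib
import Literature.Analysis.FluidPDE.SuitableWeak
import Literature.Analysis.FluidPDE.CKNInnerCylinders
import Literature.Analysis.FluidPDE.RusinSverakBackwardRegularity
import Summits.NavierStokesRegularity.NavierStokesRegularity.Theorems.StableStrataDoorFloorSurvives

/-!
# StableStrataDoorVertexBounds — scale-invariant bounds at a vertex with a local space–time Type-I rate
# (SEED-26 input I1, door S26 «StableStrataDoor»; nsreg-p6 g14)

Two quantitative bounds, UNIFORM in the solution, that feed the uniform `L³`-floor constant `c(ν, M)` of
`StableStrataDoorOneSliceDefs.LocalPointZoomAlongTimesM` (I1 v5):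

* `cknC_le_of_spaceTimeRate` — a field with the local space–time rate `‖v(s,y)‖ ≤ D/(‖y‖+√−s)` on
  `Q(r₀) = (−r₀²,0) × B_{r₀}` has `C(r) = r⁻² ∫_{Q(r)} |v|³ ≤ 6|B₁| D³` for every `0 < r ≤ r₀` (Tonelli on the
  product majorant `D³ ‖y‖⁻² (√−s)⁻¹`, the polar identity `∫_{B_r} ‖y‖⁻² = 3|B₁| r` of
  `StableStrataDoorFloorSurvives.integral_inv_norm_sq_ball`, and `∫_{−r²}^0 (√−s)⁻¹ ds = 2r`);
* `exists_cknD_le_of_cknC_le` — Seregin–Šverák's pressure decay (as13) iterated (tree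
  `cknD_iterate_le_of_pressure_decay`): if `C(r) ≤ e` for `0 < r ≤ r₀` and `D(r₀) < ∞`, then
  `D(r) ≤ θ⁻² (1 + 2 c θ⁻² e)` for all `0 < r ≤ r₂`, some `r₂ = r₂(solution) ≤ r₀`, where `c, θ` are the ABSOLUTE
  constants of the decay estimate — the bound is a function of `e` alone.

WHAT THIS IS NOT: not NS regularity (Clay A); bookkeeping lemmas for a compactness input of a criterion INSIDE the
Type-I class; no route, no item.
-/

noncomputable section

set_option linter.dupNamespace false

namespace Summit.NavierStokesRegularity.NavierStokesRegularity.Theorems.StableStrataDoorVertexBounds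

open MeasureTheory Set Function Filter Topology TopologicalSpace Metric
open scoped RealInnerProductSpace NNReal ENNReal Topology
open Literature.Analysis Literature.Analysis.FluidPDE
open Summit.NavierStokesRegularity.NavierStokesRegularity.Theorems.StableStrataDoorFloorSurvives

/-! ## The time factor on `(−r², 0)` -/

/-- `∫_{−r²}^{0} (√−s)⁻¹ ds = 2r` for `r > 0`. -/
theorem integral_inv_sqrt_neg_Ioo {r : ℝ} (hr : 0 < r) :
    ∫ s in Ioo (-r ^ 2) 0, (Real.sqrt (-s))⁻¹ = 2 * r := by
  rw [← integral_Ioc_eq_integral_Ioo,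
    ← intervalIntegral.integral_of_le (by nlinarith : (-r ^ 2 : ℝ) ≤ 0),
    intervalIntegral.integral_comp_neg (fun x : ℝ => (Real.sqrt x)⁻¹), neg_zero, neg_neg]
  have heq : EqOn (fun x : ℝ => (Real.sqrt x)⁻¹) (fun x => x ^ (-(1 / 2 : ℝ))) (uIcc (0 : ℝ) (r ^ 2)) := by
    intro x hx
    rw [uIcc_of_le (by positivity : (0 : ℝ) ≤ r ^ 2)] at hx
    simp only
    rw [Real.sqrt_eq_rpow, Real.rpow_neg hx.1]
  rw [intervalIntegral.integral_congr heq, integral_rpow (Or.inl (by norm_num))]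
  rw [show (-(1 / 2 : ℝ)) + 1 = 1 / 2 by norm_num, Real.zero_rpow (by norm_num),
    ← Real.sqrt_eq_rpow, Real.sqrt_sq hr.le]
  ring

/-- `s ↦ (√−s)⁻¹` is integrable on `(−r², 0)`. -/
theorem integrableOn_inv_sqrt_neg_Ioo (r : ℝ) :
    IntegrableOn (fun s : ℝ => (Real.sqrt (-s))⁻¹) (Ioo (-r ^ 2) 0) volume := by
  have h1 : IntervalIntegrable (fun x : ℝ => x ^ (-(1 / 2 : ℝ))) volume 0 (r ^ 2) :=
    intervalIntegral.intervalIntegrable_rpow' (by norm_num)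
  have h2 := h1.comp_sub_left 0
  simp only [zero_sub, sub_zero] at h2
  have h3 : IntegrableOn (fun x : ℝ => (-x) ^ (-(1 / 2 : ℝ))) (Ioc (-r ^ 2) 0) volume := h2.2
  have h4 : IntegrableOn (fun x : ℝ => (-x) ^ (-(1 / 2 : ℝ))) (Ioo (-r ^ 2) 0) volume := by
    rwa [integrableOn_Ioc_iff_integrableOn_Ioo] at h3
  refine h4.congr_fun (fun s hs => ?_) measurableSet_Ioo
  simp only
  rw [Real.sqrt_eq_rpow, Real.rpow_neg (by linarith [hs.2])]

/-! ## `C(r) ≤ 6|B₁| D³` from the local space–time rate -/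

/-- Pointwise: `‖v‖ ≤ D/(a+b)` with `a = ‖y‖ > 0`, `b = √−s > 0` gives `‖v‖³ ≤ D³ · (‖y‖²)⁻¹ · (√−s)⁻¹`. -/
theorem norm_cube_le_of_rate {D : ℝ} (hD : 0 ≤ D) {V : EuclideanSpace ℝ (Fin 3)} {s : ℝ} (hs : s < 0)
    {y : EuclideanSpace ℝ (Fin 3)} (hy : y ≠ 0) (h : ‖V‖ ≤ D / (‖y‖ + Real.sqrt (-s))) :
    ‖V‖ ^ 3 ≤ D ^ 3 * (‖y‖ ^ 2)⁻¹ * (Real.sqrt (-s))⁻¹ := by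
  have ha : 0 < ‖y‖ := norm_pos_iff.2 hy
  have hb : 0 < Real.sqrt (-s) := Real.sqrt_pos.2 (by linarith)
  have hab : 0 < ‖y‖ + Real.sqrt (-s) := by positivity
  have h1 : ‖V‖ ^ 3 ≤ D ^ 3 / (‖y‖ + Real.sqrt (-s)) ^ 3 := by
    rw [← div_pow]
    exact pow_le_pow_left₀ (norm_nonneg _) h 3
  have h2 : ‖y‖ ^ 2 * Real.sqrt (-s) ≤ (‖y‖ + Real.sqrt (-s)) ^ 3 := by
    nlinarith [mul_pos ha hb, mul_pos (mul_pos ha ha) hb, mul_pos (mul_pos hb hb) ha, pow_pos hb 3, pow_pos ha 3]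
  calc ‖V‖ ^ 3 ≤ D ^ 3 / (‖y‖ + Real.sqrt (-s)) ^ 3 := h1
    _ ≤ D ^ 3 / (‖y‖ ^ 2 * Real.sqrt (-s)) :=
        div_le_div_of_nonneg_left (by positivity) (by positivity) h2
    _ = D ^ 3 * (‖y‖ ^ 2)⁻¹ * (Real.sqrt (-s))⁻¹ := by
        rw [div_eq_mul_inv, mul_inv, mul_assoc]

/-- **`∫_{Q(r)} ‖v‖³ ≤ 6|B₁| D³ r²`** for a field with the space–time rate `D/(‖y‖+√−s)` on `Q(r) = (−r²,0) × B_r`. -/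
theorem lintegral_cube_le_of_spaceTimeRate {v : ℝ → EuclideanSpace ℝ (Fin 3) → EuclideanSpace ℝ (Fin 3)}
    {D r : ℝ} (hD : 0 ≤ D) (hr : 0 < r)
    (hrate : ∀ s ∈ Ioo (-r ^ 2) 0, ∀ y ∈ ball (0 : EuclideanSpace ℝ (Fin 3)) r,
      ‖v s y‖ ≤ D / (‖y‖ + Real.sqrt (-s))) :
    ∫⁻ z in Ioo (-r ^ 2) 0 ×ˢ ball (0 : EuclideanSpace ℝ (Fin 3)) r, ‖v z.1 z.2‖ₑ ^ (3 : ℕ) ≤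
      ENNReal.ofReal (6 * volume.real (ball (0 : EuclideanSpace ℝ (Fin 3)) 1) * D ^ 3 * r ^ 2) := by
  set G : EuclideanSpace ℝ (Fin 3) → ℝ≥0∞ := fun y => ENNReal.ofReal (D ^ 3 * (‖y‖ ^ 2)⁻¹) with hG
  set H : ℝ → ℝ≥0∞ := fun s => ENNReal.ofReal ((Real.sqrt (-s))⁻¹) with hH
  have hSm : MeasurableSet (Ioo (-r ^ 2) 0 ×ˢ ball (0 : EuclideanSpace ℝ (Fin 3)) r) :=
    measurableSet_Ioo.prod measurableSet_ball
  -- almost every space–time point is off the axis `y = 0`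
  have hax : ∀ᵐ z : ℝ × EuclideanSpace ℝ (Fin 3) ∂volume, z.2 ≠ 0 := by
    have h0 : volume {z : ℝ × EuclideanSpace ℝ (Fin 3) | z.2 = 0} = 0 := by
      have : {z : ℝ × EuclideanSpace ℝ (Fin 3) | z.2 = 0} =
          (univ : Set ℝ) ×ˢ ({0} : Set (EuclideanSpace ℝ (Fin 3))) := by
        ext z; simp
      rw [this, Measure.volume_eq_prod, Measure.prod_prod, measure_singleton, mul_zero]
    filter_upwards [measure_eq_zero_iff_ae_notMem.1 h0] with z hz
    simpa using hz
  have hdom : ∀ᵐ z ∂volume.restrict (Ioo (-r ^ 2) 0 ×ˢ ball (0 : EuclideanSpace ℝ (Fin 3)) r),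
      ‖v z.1 z.2‖ₑ ^ (3 : ℕ) ≤ H z.1 * G z.2 := by
    rw [ae_restrict_iff' hSm]
    filter_upwards [hax] with z hz hmem
    rw [mem_prod] at hmem
    have hs : z.1 < 0 := hmem.1.2
    simp only [hG, hH]
    rw [← ofReal_norm, ← ENNReal.ofReal_pow (norm_nonneg _),
      ← ENNReal.ofReal_mul (inv_nonneg.2 (Real.sqrt_nonneg _))]
    refine ENNReal.ofReal_le_ofReal ?_
    calc ‖v z.1 z.2‖ ^ 3 ≤ D ^ 3 * (‖z.2‖ ^ 2)⁻¹ * (Real.sqrt (-z.1))⁻¹ :=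
          norm_cube_le_of_rate hD hs hz (hrate z.1 hmem.1 z.2 hmem.2)
      _ = (Real.sqrt (-z.1))⁻¹ * (D ^ 3 * (‖z.2‖ ^ 2)⁻¹) := by ring
  have hHm : Measurable H := by
    rw [hH]
    exact ((Real.continuous_sqrt.comp continuous_neg).measurable.inv).ennreal_ofReal
  have hGm : Measurable G := by
    rw [hG]
    exact (measurable_const.mul ((continuous_norm.pow 2).measurable.inv)).ennreal_ofReal
  have hprod : ∫⁻ z in Ioo (-r ^ 2) 0 ×ˢ ball (0 : EuclideanSpace ℝ (Fin 3)) r, H z.1 * G z.2 =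
      (∫⁻ s in Ioo (-r ^ 2) 0, H s) * ∫⁻ y in ball (0 : EuclideanSpace ℝ (Fin 3)) r, G y := by
    rw [Measure.volume_eq_prod, ← Measure.prod_restrict, lintegral_prod_mul hHm.aemeasurable hGm.aemeasurable]
  have hHint : ∫⁻ s in Ioo (-r ^ 2) 0, H s = ENNReal.ofReal (2 * r) := by
    rw [hH, ← ofReal_integral_eq_lintegral_ofReal (integrableOn_inv_sqrt_neg_Ioo r)
      (ae_of_all _ (fun s => inv_nonneg.2 (Real.sqrt_nonneg _))), integral_inv_sqrt_neg_Ioo hr]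
  have hGint : ∫⁻ y in ball (0 : EuclideanSpace ℝ (Fin 3)) r, G y =
      ENNReal.ofReal (D ^ 3 * (3 * volume.real (ball (0 : EuclideanSpace ℝ (Fin 3)) 1) * r)) := by
    rw [hG, ← ofReal_integral_eq_lintegral_ofReal (integrableOn_const_mul_inv_norm_sq_ball (D ^ 3) r)
      (ae_of_all _ (fun y => by positivity)), integral_const_mul (D ^ 3), integral_inv_norm_sq_ball hr]
  calc ∫⁻ z in Ioo (-r ^ 2) 0 ×ˢ ball (0 : EuclideanSpace ℝ (Fin 3)) r, ‖v z.1 z.2‖ₑ ^ (3 : ℕ)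
      ≤ ∫⁻ z in Ioo (-r ^ 2) 0 ×ˢ ball (0 : EuclideanSpace ℝ (Fin 3)) r, H z.1 * G z.2 :=
        lintegral_mono_ae hdom
    _ = ENNReal.ofReal (2 * r) *
          ENNReal.ofReal (D ^ 3 * (3 * volume.real (ball (0 : EuclideanSpace ℝ (Fin 3)) 1) * r)) := by
        rw [hprod, hHint, hGint]
    _ = ENNReal.ofReal (6 * volume.real (ball (0 : EuclideanSpace ℝ (Fin 3)) 1) * D ^ 3 * r ^ 2) := by
        rw [← ENNReal.ofReal_mul (by positivity)]
        congr 1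
        ring

/-- **`C(r; v, 0) ≤ 6|B₁| D³`** at every scale `0 < r ≤ r₀` for a field with the local space–time Type-I rate
`‖v(s,y)‖ ≤ D/(‖y‖+√−s)` on `Q(r₀)` — a bound UNIFORM in the field (scale invariance of `C`). -/
theorem cknC_le_of_spaceTimeRate {v : ℝ → EuclideanSpace ℝ (Fin 3) → EuclideanSpace ℝ (Fin 3)}
    {D r₀ : ℝ} (hD : 0 ≤ D)
    (hrate : ∀ s ∈ Ioo (-r₀ ^ 2) 0, ∀ y ∈ ball (0 : EuclideanSpace ℝ (Fin 3)) r₀,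
      ‖v s y‖ ≤ D / (‖y‖ + Real.sqrt (-s)))
    {r : ℝ} (hr : r ∈ Ioc 0 r₀) :
    cknC r (0 : ℝ × EuclideanSpace ℝ (Fin 3)) v ≤
      ENNReal.ofReal (6 * volume.real (ball (0 : EuclideanSpace ℝ (Fin 3)) 1) * D ^ 3) := by
  have hr0 : 0 < r := hr.1
  have hrate' : ∀ s ∈ Ioo (-r ^ 2) 0, ∀ y ∈ ball (0 : EuclideanSpace ℝ (Fin 3)) r,
      ‖v s y‖ ≤ D / (‖y‖ + Real.sqrt (-s)) := by
    intro s hs y hy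
    refine hrate s ⟨?_, hs.2⟩ y (ball_subset_ball hr.2 hy)
    have : r ^ 2 ≤ r₀ ^ 2 := pow_le_pow_left₀ hr0.le hr.2 2
    linarith [hs.1]
  have hQ : parabolicCylinder r (0 : ℝ × EuclideanSpace ℝ (Fin 3)) =
      Ioo (-r ^ 2) 0 ×ˢ ball (0 : EuclideanSpace ℝ (Fin 3)) r := by
    simp [parabolicCylinder]
  have hkey := lintegral_cube_le_of_spaceTimeRate hD hr0 hrate'
  rw [cknC, hQ]
  have hr2 : (ENNReal.ofReal r ^ 2) ≠ 0 := pow_ne_zero _ ((ENNReal.ofReal_pos.2 hr0).ne')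
  have hr2' : (ENNReal.ofReal r ^ 2) ≠ ∞ := ENNReal.pow_ne_top ENNReal.ofReal_ne_top
  calc (ENNReal.ofReal r ^ 2)⁻¹ *
        ∫⁻ q in Ioo (-r ^ 2) 0 ×ˢ ball (0 : EuclideanSpace ℝ (Fin 3)) r, ‖v q.1 q.2‖ₑ ^ (3 : ℕ)
      ≤ (ENNReal.ofReal r ^ 2)⁻¹ *
          ENNReal.ofReal (6 * volume.real (ball (0 : EuclideanSpace ℝ (Fin 3)) 1) * D ^ 3 * r ^ 2) :=
        mul_le_mul' le_rfl hkey
    _ = (ENNReal.ofReal r ^ 2)⁻¹ * (ENNReal.ofReal r ^ 2 *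
          ENNReal.ofReal (6 * volume.real (ball (0 : EuclideanSpace ℝ (Fin 3)) 1) * D ^ 3)) := by
        rw [← ENNReal.ofReal_pow hr0.le, ← ENNReal.ofReal_mul (by positivity)]
        congr 2
        ring
    _ = ENNReal.ofReal (6 * volume.real (ball (0 : EuclideanSpace ℝ (Fin 3)) 1) * D ^ 3) := by
        rw [← mul_assoc, ENNReal.inv_mul_cancel hr2 hr2', one_mul]

/-! ## `D(r) ≤ L(e)` at small scales from `C(r) ≤ e` (pressure decay iterated) -/

/-- **Scaled pressure bound at small scales from a cubic bound** (Seregin–Šverák 2009 (as13) iterated, tree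
`cknD_iterate_le_of_pressure_decay`): with the absolute constants `c` (ratio form of the decay estimate) and `θ`
(`0 < θ < 1`, `cθ ≤ 1/2`), if `(u,p)` is a distributional solution on `Q ⊇ Q_{r₀}(z)`, `D(r₀; z) < ∞` and
`C(r; z) ≤ e` for `0 < r ≤ r₀`, then for some `0 < r₂ ≤ r₀` (depending on the solution) and ALL `0 < r ≤ r₂`,
`D(r; z) ≤ θ⁻² (1 + 2 c θ⁻² e)` — a level depending on `e` alone. -/
theorem exists_cknD_le_of_cknC_le {c : ℝ≥0}
    (hPD : ∀ (Q : Opens (ℝ × EuclideanSpace ℝ (Fin 3)))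
      (u : ℝ → EuclideanSpace ℝ (Fin 3) → EuclideanSpace ℝ (Fin 3)) (p : ℝ → EuclideanSpace ℝ (Fin 3) → ℝ),
      IsDistributionalNSSolutionOn Q 1 0 u p →
      ∀ (z : ℝ × EuclideanSpace ℝ (Fin 3)) (r θ : ℝ), 0 < r → 0 < θ → θ ≤ 1 →
        parabolicCylinder r z ⊆ (Q : Set (ℝ × EuclideanSpace ℝ (Fin 3))) →
        cknD (θ * r) z p ≤
          c * (ENNReal.ofReal θ * cknD r z p + ENNReal.ofReal ((θ⁻¹) ^ 2) * cknC r z u))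
    {θ : ℝ} (hθ : 0 < θ) (hθ1 : θ < 1) (hcθ : (c : ℝ≥0∞) * ENNReal.ofReal θ ≤ 2⁻¹)
    {Q : Opens (ℝ × EuclideanSpace ℝ (Fin 3))} {u : ℝ → EuclideanSpace ℝ (Fin 3) → EuclideanSpace ℝ (Fin 3)}
    {p : ℝ → EuclideanSpace ℝ (Fin 3) → ℝ} (hdist : IsDistributionalNSSolutionOn Q 1 0 u p)
    {z : ℝ × EuclideanSpace ℝ (Fin 3)} {r₀ : ℝ} (hr₀ : 0 < r₀)
    (hsub : parabolicCylinder r₀ z ⊆ (Q : Set (ℝ × EuclideanSpace ℝ (Fin 3))))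
    (hDfin : cknD r₀ z p ≠ ∞) {e : ℝ≥0∞} (hC : ∀ r ∈ Ioc (0 : ℝ) r₀, cknC r z u ≤ e) :
    ∃ r₂ ∈ Ioc (0 : ℝ) r₀, ∀ r ∈ Ioc (0 : ℝ) r₂,
      cknD r z p ≤ ENNReal.ofReal ((θ⁻¹) ^ 2) * (1 + 2 * ((c : ℝ≥0∞) * ENNReal.ofReal ((θ⁻¹) ^ 2) * e)) := by
  -- `J₀` with `2^{-J₀} D(r₀) ≤ 1`
  have hgeo : Tendsto (fun J : ℕ => (2⁻¹ : ℝ≥0∞) ^ J * cknD r₀ z p) atTop (𝓝 0) := by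
    have h1 : Tendsto (fun J : ℕ => (2⁻¹ : ℝ≥0∞) ^ J) atTop (𝓝 0) :=
      ENNReal.tendsto_pow_atTop_nhds_zero_iff.2 (by norm_num)
    have h2 := ENNReal.Tendsto.mul_const h1 (Or.inr hDfin)
    rwa [zero_mul] at h2
  obtain ⟨J₀, hJ₀⟩ := (hgeo.eventually (Iic_mem_nhds zero_lt_one)).exists
  have hJ : ∀ J, J₀ ≤ J → (2⁻¹ : ℝ≥0∞) ^ J * cknD r₀ z p ≤ 1 := by
    intro J hJ
    refine le_trans ?_ hJ₀
    exact mul_le_mul' (pow_le_pow_right_of_le_one' (by norm_num) hJ) le_rfl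
  -- the radius `r₂ = θ^{J₀} r₀`
  refine ⟨θ ^ J₀ * r₀, ⟨by positivity, mul_le_of_le_one_left hr₀.le (pow_le_one₀ hθ.le hθ1.le)⟩,
    fun r hr => ?_⟩
  -- locate `r` between consecutive scales: `θ^{n+1} r₀ < r ≤ θ^n r₀`, `n ≥ J₀`
  have hx : 0 < r / r₀ := div_pos hr.1 hr₀
  have hx1 : r / r₀ ≤ 1 := by
    rw [div_le_one hr₀]
    exact hr.2.trans (mul_le_of_le_one_left hr₀.le (pow_le_one₀ hθ.le hθ1.le))
  obtain ⟨n, hn1, hn2⟩ := exists_nat_pow_near_of_lt_one hx hx1 hθ hθ1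
  have hnJ : J₀ ≤ n := by
    by_contra hlt
    have hle : n + 1 ≤ J₀ := by omega
    have h1 : θ ^ J₀ ≤ θ ^ (n + 1) := pow_le_pow_of_le_one hθ.le hθ1.le hle
    have h2 : r / r₀ ≤ θ ^ J₀ := by
      rw [div_le_iff₀ hr₀]
      exact hr.2
    linarith
  -- the iterated decay estimate at the scale `θ^n r₀`
  have hCj : ∀ j < n, cknC (θ ^ j * r₀) z u ≤ e := fun j _ =>
    hC _ ⟨by positivity, mul_le_of_le_one_left hr₀.le (pow_le_one₀ hθ.le hθ1.le)⟩
  have hiter := cknD_iterate_le_of_pressure_decay hPD hθ hθ1.le hcθ hdist hr₀ hsub hCj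
  have hDn : cknD (θ ^ n * r₀) z p ≤ 1 + 2 * ((c : ℝ≥0∞) * ENNReal.ofReal ((θ⁻¹) ^ 2) * e) :=
    hiter.trans (add_le_add (hJ n hnJ) le_rfl)
  -- monotonicity from `r` up to `θ^n r₀ < θ⁻¹ r`
  have hrn : r ≤ θ ^ n * r₀ := by
    have := hn2; rwa [div_le_iff₀ hr₀] at this
  have hrn' : θ ^ n * r₀ / r ≤ θ⁻¹ := by
    rw [div_le_iff₀ hr.1]
    have h1 : θ ^ (n + 1) * r₀ < r := by
      have := hn1; rwa [lt_div_iff₀ hr₀] at this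
    rw [pow_succ] at h1
    have hθn : 0 < θ ^ n * r₀ := by positivity
    calc θ ^ n * r₀ = θ⁻¹ * (θ ^ n * θ * r₀) := by field_simp
      _ ≤ θ⁻¹ * r := mul_le_mul_of_nonneg_left h1.le (inv_nonneg.2 hθ.le)
  have hmono := cknD_le_mul_of_subset (by positivity : 0 < θ ^ n * r₀) hr.1
    (parabolicCylinder_mono hr.1.le hrn z) p
  calc cknD r z p ≤ ENNReal.ofReal (θ ^ n * r₀ / r) ^ 2 * cknD (θ ^ n * r₀) z p := hmono
    _ ≤ ENNReal.ofReal (θ⁻¹) ^ 2 * (1 + 2 * ((c : ℝ≥0∞) * ENNReal.ofReal ((θ⁻¹) ^ 2) * e)) :=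
        mul_le_mul' (pow_le_pow_left' (ENNReal.ofReal_le_ofReal hrn') 2) hDn
    _ = ENNReal.ofReal ((θ⁻¹) ^ 2) * (1 + 2 * ((c : ℝ≥0∞) * ENNReal.ofReal ((θ⁻¹) ^ 2) * e)) := by
        rw [ENNReal.ofReal_pow (inv_nonneg.2 hθ.le)]

end Summit.NavierStokesRegularity.NavierStokesRegularity.Theorems.StableStrataDoorVertexBounds
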